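import Mathlib
import Summits.Ventures.HodgeRepro2.T5EisensteinField
import Summits.Ventures.HodgeRepro2.T5EisensteinPlace
import Summits.Ventures.HodgeRepro2.T5EisensteinInertPlace
import Summits.Ventures.HodgeRepro2.T5EisensteinSplitPlace
import Summits.Ventures.HodgeRepro2.T5CompletionDegreeSum
import Summits.Ventures.HodgeRepro2.T6N5LocalGaussianWitness
import Summits.Ventures.HodgeRepro2.T6N5LocalInertWitness
import Summits.Ventures.HodgeRepro2.T6N5LocalSignModelGlobalWitness

/-!
# T6N5LocalSignModelDichotomy — Tier 6, M2 sub-step N5 (t6-p8's half): the inert / ramified dichotomy of the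
place data is EXCLUSIVE, so the branch chosen by `placeData` is DECIDED by the arithmetic of the place

`T6N5LocalSignModelGlobal.placeData v w hKL huniq : InertPlace v w ⊕ RamPlace v w` is a CHOICE (`Nonempty.some`)
between the two kinds of place data; the route's reading «at `2` in `ℚ(ζ₄)` the chosen branch is the ramified one»
was, until this file, a mathematical remark (owner file §24, precision line) that the kernel did not decide. It does
now:
* `irreducible_algebraMap_iff` — two uniformisers of `K_v` are associated
  (`IsDiscreteValuationRing.associated_of_irreducible`), so whether a uniformiser of `K_v` stays irreducible in
  `O_{L_w}` does not depend on the uniformiser;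
* `exclusive` — no place carries both an `InertPlace` and a `RamPlace` (the former's uniformiser stays irreducible,
  the latter's does not); `isEmpty_inertPlace` / `isEmpty_ramPlace`;
* `eq_inr_of_ramPlace` / `eq_inl_of_inertPlace` / `placeData_eq_inr` / `placeData_eq_inl` — ANY place data, in
  particular the chosen `placeData`, are of the kind a witness of either kind dictates; `D_eq_ramDatum` /
  `D_eq_inertDatum` / `hyps_iff_ramHyps` / `hyps_iff_inertHyps` — the local sign datum and the hypotheses of a
  `LocalInput` are those of the statement of record of that kind; `toyInput_placeData_eq_ram` / `_eq_inert` — the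
  toy input at the chosen place data is the toy of that kind;
* `nonempty_ramPlace_iff` / `nonempty_inertPlace_iff` / `nonempty_inertPlace_iff_isEmpty_ramPlace` — under the
  global hypotheses (`[L : K] = 2`, `w` the only place above `v`) a ramified (inert) datum exists iff a uniformiser
  of `K_v` stops being (stays) irreducible in `O_{L_w}`, and exactly one of the two kinds occurs;
* on `ℚ ⊆ ℚ(ζ₄)` at `2` (p4's `T5GaussianPlace`, `T6N5LocalGaussianWitness.gaussianPlace`):
  `isEmpty_inertPlace_v₂`, `placeData_v₂_eq_inr`, **`localInputAt_toyFamily_v₂`** (the toy family's local input at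
  `2` IS the ramified toy input), `ofGlobal_toyFamily_D_v₂`, **`gaussian_global_witness_ram`**
  (`gaussian_global_witness` read at `2`: the datum there is the ramified statement of record's datum on the gen-6
  ramified toy, and `Solves` there is Theorem N5.T2 on it);
* on `ℚ ⊆ ℚ(ζ₃)` (p4's `T5EisensteinInertPlace` at `2`, `T5EisensteinPlace` at `3`, `T5EisensteinSplitPlace` at
  `7`): `isEmpty_ramPlace_v₂_L₃` / `isNonSplit_v₂_L₃` / `placeData_v₂_L₃_eq_inl` (inert), `eisensteinRamPlace` /
  `isNonSplit_v₃` / `placeData_v₃_eq_inr` (tame ramified), `not_isNonSplit_v₇` / `kindOf_v₇` (split), and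
  **`kindOf_surjective_L₃`** — every value of `PlaceKind` occurs among the places of `ℚ` relative to `ℚ(ζ₃)`
  (README §10.5(ii)(c): none of the three clauses of a sign model on `GlobalIndex ℚ` is vacuous).
Definition lane, Mathlib + the cell's files only; no display. Nothing here touches the host datum.
README §8(d): uses an L-value-free non-vanishing device: NO.
-/

namespace Summit.Ventures.HodgeRepro2.T6.N5LocalSignModelDichotomy

open Summit.Ventures.HodgeRepro2 IsDedekindDomain HeightOneSpectrum
  Summit.Ventures.HodgeRepro2.T6.N5LocalDatum Summit.Ventures.HodgeRepro2.T6.N5Local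
  Summit.Ventures.HodgeRepro2.T6.N5LocalTateChars Summit.Ventures.HodgeRepro2.T6.N5LocalWeilQuotient
  Summit.Ventures.HodgeRepro2.T6.N5LocalQuotientToy Summit.Ventures.HodgeRepro2.T6.N5LocalRamToyEps
  Summit.Ventures.HodgeRepro2.T6.N5LocalInertToyEps Summit.Ventures.HodgeRepro2.T6.N5LocalRamCompletion
  Summit.Ventures.HodgeRepro2.T6.N5LocalInertCompletion Summit.Ventures.HodgeRepro2.T6.N5Rich
  Summit.Ventures.HodgeRepro2.T6.N5RealPlace Summit.Ventures.HodgeRepro2.T6.N5LocalSignModel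
  Summit.Ventures.HodgeRepro2.T6.N5LocalSignModelGlobal
  Summit.Ventures.HodgeRepro2.T6.N5LocalSignModelGlobalWitness

noncomputable section

/-! ### The dichotomy is exclusive -/

section General

variable {K : Type} [Field K] [NumberField K] (v : HeightOneSpectrum (NumberField.RingOfIntegers K))
  {L : Type} [Field L] [NumberField L] [Algebra K L] (w : HeightOneSpectrum (NumberField.RingOfIntegers L))
  [w.asIdeal.LiesOver v.asIdeal]

/-- Two uniformisers of `K_v` are associated (`IsDiscreteValuationRing.associated_of_irreducible`) and associated
elements have associated images under `algebraMap`; so «`ϖ` stays irreducible in `O_{L_w}`» does not depend on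
the uniformiser `ϖ`. -/
theorem irreducible_algebraMap_iff {ϖ ϖ' : v.adicCompletionIntegers K} (hϖ : Irreducible ϖ)
    (hϖ' : Irreducible ϖ') :
    Irreducible (algebraMap (v.adicCompletionIntegers K) (w.adicCompletionIntegers L) ϖ) ↔
      Irreducible (algebraMap (v.adicCompletionIntegers K) (w.adicCompletionIntegers L) ϖ') :=
  ((IsDiscreteValuationRing.associated_of_irreducible (v.adicCompletionIntegers K) hϖ hϖ').map
    (algebraMap (v.adicCompletionIntegers K) (w.adicCompletionIntegers L))).irreducible_iff

/-- THE DICHOTOMY IS EXCLUSIVE: no place carries both an inert datum and a ramified datum — the inert datum's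
uniformiser stays irreducible in `O_{L_w}`, the ramified datum's does not, and the two are associated. -/
theorem exclusive (Q : InertPlace v w) (Q' : RamPlace v w) : False :=
  Q'.hram ((irreducible_algebraMap_iff v w Q.hϖ Q'.hϖ).mp Q.hϖS)

/-- A ramified datum rules out every inert datum. -/
theorem isEmpty_inertPlace (Q' : RamPlace v w) : IsEmpty (InertPlace v w) :=
  ⟨fun Q => exclusive v w Q Q'⟩

/-- An inert datum rules out every ramified datum. -/
theorem isEmpty_ramPlace (Q : InertPlace v w) : IsEmpty (RamPlace v w) :=
  ⟨fun Q' => exclusive v w Q Q'⟩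

/-- ANY place data are ramified when a ramified datum exists. -/
theorem eq_inr_of_ramPlace (pd : InertPlace v w ⊕ RamPlace v w) (Q' : RamPlace v w) :
    ∃ Q : RamPlace v w, pd = Sum.inr Q := by
  rcases pd with Q | Q
  · exact (exclusive v w Q Q').elim
  · exact ⟨Q, rfl⟩

/-- ANY place data are inert when an inert datum exists. -/
theorem eq_inl_of_inertPlace (pd : InertPlace v w ⊕ RamPlace v w) (Q : InertPlace v w) :
    ∃ Q' : InertPlace v w, pd = Sum.inl Q' := by
  rcases pd with Q' | Q'
  · exact ⟨Q', rfl⟩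
  · exact (exclusive v w Q Q').elim

/-- THE CHOSEN PLACE DATA ARE DECIDED: `placeData` is ramified when a ramified datum exists. -/
theorem placeData_eq_inr (hKL : Module.finrank K L = 2)
    (huniq : ∀ w' : HeightOneSpectrum (NumberField.RingOfIntegers L), w'.asIdeal.LiesOver v.asIdeal → w' = w)
    (Q' : RamPlace v w) : ∃ Q : RamPlace v w, placeData v w hKL huniq = Sum.inr Q :=
  eq_inr_of_ramPlace v w _ Q'

/-- … and inert when an inert datum exists. -/
theorem placeData_eq_inl (hKL : Module.finrank K L = 2)
    (huniq : ∀ w' : HeightOneSpectrum (NumberField.RingOfIntegers L), w'.asIdeal.LiesOver v.asIdeal → w' = w)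
    (Q : InertPlace v w) : ∃ Q' : InertPlace v w, placeData v w hKL huniq = Sum.inl Q' :=
  eq_inl_of_inertPlace v w _ Q

/-- The local sign datum of an input at a place carrying a ramified datum is the RAMIFIED statement of record's
datum. -/
theorem D_eq_ramDatum (X : LocalInput v w) (Q' : RamPlace v w) : ∃ Q : RamPlace v w, X.D = X.ramDatum Q := by
  obtain ⟨Q, hQ⟩ := eq_inr_of_ramPlace v w X.place Q'
  exact ⟨Q, X.D_inr hQ⟩

/-- … and at a place carrying an inert datum the INERT statement of record's datum. -/
theorem D_eq_inertDatum (X : LocalInput v w) (Q : InertPlace v w) :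
    ∃ Q' : InertPlace v w, X.D = X.inertDatum Q' := by
  obtain ⟨Q', hQ'⟩ := eq_inl_of_inertPlace v w X.place Q
  exact ⟨Q', X.D_inl hQ'⟩

/-- The hypotheses of an input at a place carrying a ramified datum are the RAMIFIED hypotheses. -/
theorem hyps_iff_ramHyps (X : LocalInput v w) (Q' : RamPlace v w) :
    ∃ Q : RamPlace v w, (X.Hyps ↔ X.RamHyps Q) := by
  obtain ⟨Q, hQ⟩ := eq_inr_of_ramPlace v w X.place Q'
  exact ⟨Q, by simp only [LocalInput.Hyps, hQ, Sum.elim_inr]⟩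

/-- … and at a place carrying an inert datum the INERT hypotheses. -/
theorem hyps_iff_inertHyps (X : LocalInput v w) (Q : InertPlace v w) :
    ∃ Q' : InertPlace v w, (X.Hyps ↔ X.InertHyps Q') := by
  obtain ⟨Q', hQ'⟩ := eq_inl_of_inertPlace v w X.place Q
  exact ⟨Q', by simp only [LocalInput.Hyps, hQ', Sum.elim_inl]⟩

/-- The toy input at the chosen place data is the RAMIFIED toy when a ramified datum exists. -/
theorem toyInput_placeData_eq_ram (hKL : Module.finrank K L = 2)
    (huniq : ∀ w' : HeightOneSpectrum (NumberField.RingOfIntegers L), w'.asIdeal.LiesOver v.asIdeal → w' = w)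
    (Q' : RamPlace v w) :
    ∃ Q : RamPlace v w, toyInput v w (placeData v w hKL huniq) = toyInputRam v w Q := by
  obtain ⟨Q, hQ⟩ := placeData_eq_inr v w hKL huniq Q'
  exact ⟨Q, congrArg (toyInput v w) hQ⟩

/-- … and the INERT toy when an inert datum exists. -/
theorem toyInput_placeData_eq_inert (hKL : Module.finrank K L = 2)
    (huniq : ∀ w' : HeightOneSpectrum (NumberField.RingOfIntegers L), w'.asIdeal.LiesOver v.asIdeal → w' = w)
    (Q : InertPlace v w) :
    ∃ Q' : InertPlace v w, toyInput v w (placeData v w hKL huniq) = toyInputInert v w Q' := by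
  obtain ⟨Q', hQ'⟩ := placeData_eq_inl v w hKL huniq Q
  exact ⟨Q', congrArg (toyInput v w) hQ'⟩

/-- Under the global hypotheses, a RAMIFIED datum exists iff some uniformiser of `K_v` stops being irreducible in
`O_{L_w}` (equivalently every one, `irreducible_algebraMap_iff`). -/
theorem nonempty_ramPlace_iff (hKL : Module.finrank K L = 2)
    (huniq : ∀ w' : HeightOneSpectrum (NumberField.RingOfIntegers L), w'.asIdeal.LiesOver v.asIdeal → w' = w) :
    Nonempty (RamPlace v w) ↔ ∃ ϖ : v.adicCompletionIntegers K, Irreducible ϖ ∧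
      ¬ Irreducible (algebraMap (v.adicCompletionIntegers K) (w.adicCompletionIntegers L) ϖ) := by
  constructor
  · rintro ⟨Q⟩
    exact ⟨Q.ϖ, Q.hϖ, Q.hram⟩
  · rintro ⟨ϖ, hϖ, hram⟩
    rcases placeData v w hKL huniq with Q | Q
    · exact absurd ((irreducible_algebraMap_iff v w Q.hϖ hϖ).mp Q.hϖS) hram
    · exact ⟨Q⟩

/-- Under the global hypotheses, an INERT datum exists iff some uniformiser of `K_v` stays irreducible in
`O_{L_w}`. -/
theorem nonempty_inertPlace_iff (hKL : Module.finrank K L = 2)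
    (huniq : ∀ w' : HeightOneSpectrum (NumberField.RingOfIntegers L), w'.asIdeal.LiesOver v.asIdeal → w' = w) :
    Nonempty (InertPlace v w) ↔ ∃ ϖ : v.adicCompletionIntegers K, Irreducible ϖ ∧
      Irreducible (algebraMap (v.adicCompletionIntegers K) (w.adicCompletionIntegers L) ϖ) := by
  constructor
  · rintro ⟨Q⟩
    exact ⟨Q.ϖ, Q.hϖ, Q.hϖS⟩
  · rintro ⟨ϖ, hϖ, hS⟩
    rcases placeData v w hKL huniq with Q | Q
    · exact ⟨Q⟩
    · exact absurd ((irreducible_algebraMap_iff v w hϖ Q.hϖ).mp hS) Q.hram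

/-- EXACTLY ONE of the two kinds occurs at the only place above `v`. -/
theorem nonempty_inertPlace_iff_isEmpty_ramPlace (hKL : Module.finrank K L = 2)
    (huniq : ∀ w' : HeightOneSpectrum (NumberField.RingOfIntegers L), w'.asIdeal.LiesOver v.asIdeal → w' = w) :
    Nonempty (InertPlace v w) ↔ IsEmpty (RamPlace v w) := by
  constructor
  · rintro ⟨Q⟩
    exact isEmpty_ramPlace v w Q
  · intro h
    rcases placeData v w hKL huniq with Q | Q
    · exact ⟨Q⟩
    · exact h.elim Q

end General

/-! ### `ℚ ⊆ ℚ(ζ₄)` at `2`: the chosen branch is the ramified one, and the witness read at `2` -/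

section Gaussian

open T5GaussianField

variable (w : HeightOneSpectrum (NumberField.RingOfIntegers T5GaussianField.L)) [w.asIdeal.LiesOver v₂.asIdeal]

/-- `2` in `ℚ(ζ₄)` is RAMIFIED: no inert datum exists at any place above it (p4's
`T5GaussianPlace.not_irreducible_algebraMap_two` through `T6N5LocalGaussianWitness.gaussianPlace`). -/
theorem isEmpty_inertPlace_v₂ : IsEmpty (InertPlace v₂ w) :=
  isEmpty_inertPlace v₂ w (N5LocalGaussianWitness.gaussianPlace w)

/-- THE CHOSEN PLACE DATA AT `2` ARE RAMIFIED. -/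
theorem placeData_v₂_eq_inr
    (huniq : ∀ w' : HeightOneSpectrum (NumberField.RingOfIntegers T5GaussianField.L),
      w'.asIdeal.LiesOver v₂.asIdeal → w' = w) :
    ∃ Q : RamPlace v₂ w, placeData v₂ w T5GaussianField.finrank_eq_two huniq = Sum.inr Q :=
  placeData_eq_inr v₂ w T5GaussianField.finrank_eq_two huniq (N5LocalGaussianWitness.gaussianPlace w)

omit [w.asIdeal.LiesOver v₂.asIdeal] in
/-- THE READING OF THE WITNESS IN KERNEL: the toy family's local input at `2` IS the ramified toy input (the
kernel decides the branch the owner file §24 left to the mathematics). -/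
theorem localInputAt_toyFamily_v₂ :
    ∃ Q : RamPlace v₂ (placeAbove isNonSplit_v₂),
      localInputAt T5GaussianField.finrank_eq_two toyFamily isNonSplit_v₂ =
        toyInputRam v₂ (placeAbove isNonSplit_v₂) Q := by
  obtain ⟨Q, hQ⟩ := toyInput_placeData_eq_ram v₂ (placeAbove isNonSplit_v₂) T5GaussianField.finrank_eq_two
    (placeAbove_unique isNonSplit_v₂) (N5LocalGaussianWitness.gaussianPlace _)
  exact ⟨Q, (ofUnique_toyThreeData v₂ (placeAbove isNonSplit_v₂) T5GaussianField.finrank_eq_two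
    (placeAbove_unique isNonSplit_v₂)).trans hQ⟩

omit [w.asIdeal.LiesOver v₂.asIdeal] in
/-- The datum of the global toy family at `2` is the ramified statement of record's datum on the ramified toy. -/
theorem ofGlobal_toyFamily_D_v₂ :
    ∃ Q : RamPlace v₂ (placeAbove isNonSplit_v₂),
      (PlaceFamily.ofGlobal T5GaussianField.finrank_eq_two toyFamily).D (Sum.inl v₂) =
        (toyInputRam v₂ (placeAbove isNonSplit_v₂) Q).D := by
  obtain ⟨Q, hQ⟩ := localInputAt_toyFamily_v₂
  refine ⟨Q, ?_⟩
  rw [PlaceFamily.D_of_ns _ kindOf_v₂]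
  exact congrArg LocalInput.D hQ

omit [w.asIdeal.LiesOver v₂.asIdeal] in
/-- `gaussian_global_witness` READ AT `2`: the sign model's datum at `2` is the ramified statement of record's datum
on the gen-6 ramified toy, and its `Solves` conjunct at `2` is Theorem N5.T2 on that datum. -/
theorem gaussian_global_witness_ram :
    ∃ S : SignModel (GlobalIndex ℚ), S.kind = kindOf ℚ T5GaussianField.L ∧
      (∃ Q : RamPlace v₂ (placeAbove isNonSplit_v₂),
        S.D (Sum.inl v₂) = (toyInputRam v₂ (placeAbove isNonSplit_v₂) Q).D) ∧
      LocalSolution (S.D (Sum.inl v₂)) (S.ξ (Sum.inl v₂)) ∧ S.Solves ∧ S.RealCondB := by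
  obtain ⟨S, hk, hD, hsol, hre⟩ := gaussian_global_witness
  obtain ⟨Q, hQ⟩ := ofGlobal_toyFamily_D_v₂
  refine ⟨S, hk, ⟨Q, ?_⟩, hsol (Sum.inl v₂) (by rw [hk]; exact kindOf_v₂), hsol, hre⟩
  rw [hD]
  exact hQ

end Gaussian

/-! ### `ℚ ⊆ ℚ(ζ₃)`: inert at `2`, tame ramified at `3`, split at `7` — all three kinds occur -/

section Eisenstein

open T5EisensteinField

variable (w : HeightOneSpectrum (NumberField.RingOfIntegers L₃)) [w.asIdeal.LiesOver T5GaussianField.v₂.asIdeal]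

/-- `2` in `ℚ(ζ₃)` is INERT: no ramified datum exists at any place above it (p4's
`T5EisensteinInertPlace.irreducible_algebraMap_two` through `T6N5LocalInertWitness.eisensteinPlace`). -/
theorem isEmpty_ramPlace_v₂_L₃ : IsEmpty (RamPlace T5GaussianField.v₂ w) :=
  isEmpty_ramPlace T5GaussianField.v₂ w (N5LocalInertWitness.eisensteinPlace w)

omit [w.asIdeal.LiesOver T5GaussianField.v₂.asIdeal] in
/-- `2` IS NON-SPLIT in `ℚ(ζ₃)`: a place above it exists and, its completion having degree `2`, it is the only
one. -/
theorem isNonSplit_v₂_L₃ : IsNonSplit ℚ L₃ T5GaussianField.v₂ := by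
  obtain ⟨w, hw⟩ := T5EisensteinInertPlace.exists_liesOver
  haveI := hw
  exact ⟨w, hw, fun w' hw' => T5CompletionDegreeSum.unique_of_finrank_eq_two T5GaussianField.v₂
    T5EisensteinField.finrank_eq_two w (T5EisensteinInertPlace.finrank_eq_two w) w' hw'⟩

/-- THE CHOSEN PLACE DATA AT `2` IN `ℚ(ζ₃)` ARE INERT. -/
theorem placeData_v₂_L₃_eq_inl
    (huniq : ∀ w' : HeightOneSpectrum (NumberField.RingOfIntegers L₃),
      w'.asIdeal.LiesOver T5GaussianField.v₂.asIdeal → w' = w) :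
    ∃ Q : InertPlace T5GaussianField.v₂ w,
      placeData T5GaussianField.v₂ w T5EisensteinField.finrank_eq_two huniq = Sum.inl Q :=
  placeData_eq_inl T5GaussianField.v₂ w T5EisensteinField.finrank_eq_two huniq
    (N5LocalInertWitness.eisensteinPlace w)

variable (w₃ : HeightOneSpectrum (NumberField.RingOfIntegers L₃)) [w₃.asIdeal.LiesOver v₃.asIdeal]

/-- THE RAMIFIED DATUM AT THE TAME PLACE `3` OF `ℚ(ζ₃)` (p4's `T5EisensteinPlace`: `[L_w : K_v] = 2`, `ϖ = 3`,
`π = 1 − ω`, `3` not irreducible in `O_{L_w}`, a non-trivial automorphism). -/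
def eisensteinRamPlace : RamPlace v₃ w₃ where
  h2 := T5EisensteinPlace.finrank_eq_two w₃
  ϖ := 3
  hϖ := T5EisensteinPlace.irreducible_three
  π := T5EisensteinPlace.π w₃
  hπ := T5EisensteinPlace.irreducible_pi w₃
  hram := T5EisensteinPlace.not_irreducible_algebraMap_three w₃
  σ := (T5EisensteinPlace.exists_algEquiv_ne_one w₃).choose
  hσ := (T5EisensteinPlace.exists_algEquiv_ne_one w₃).choose_spec

/-- `3` in `ℚ(ζ₃)` is RAMIFIED: no inert datum exists at any place above it. -/
theorem isEmpty_inertPlace_v₃ : IsEmpty (InertPlace v₃ w₃) :=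
  isEmpty_inertPlace v₃ w₃ (eisensteinRamPlace w₃)

omit [w₃.asIdeal.LiesOver v₃.asIdeal] in
/-- `3` IS NON-SPLIT in `ℚ(ζ₃)`. -/
theorem isNonSplit_v₃ : IsNonSplit ℚ L₃ v₃ := by
  obtain ⟨w, hw⟩ := T5EisensteinPlace.exists_liesOver
  haveI := hw
  exact ⟨w, hw, fun w' hw' => T5CompletionDegreeSum.unique_of_finrank_eq_two v₃
    T5EisensteinField.finrank_eq_two w (T5EisensteinPlace.finrank_eq_two w) w' hw'⟩

/-- THE CHOSEN PLACE DATA AT `3` IN `ℚ(ζ₃)` ARE RAMIFIED. -/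
theorem placeData_v₃_eq_inr
    (huniq : ∀ w' : HeightOneSpectrum (NumberField.RingOfIntegers L₃),
      w'.asIdeal.LiesOver v₃.asIdeal → w' = w₃) :
    ∃ Q : RamPlace v₃ w₃, placeData v₃ w₃ T5EisensteinField.finrank_eq_two huniq = Sum.inr Q :=
  placeData_eq_inr v₃ w₃ T5EisensteinField.finrank_eq_two huniq (eisensteinRamPlace w₃)

/-- `7` SPLITS in `ℚ(ζ₃)`: every place above it has local degree `1` (p4's `T5EisensteinSplitPlace`), which
forces a second place above it (`T5CompletionDegreeSum.exists_ne_of_finrank_eq_one`). -/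
theorem not_isNonSplit_v₇ : ¬ IsNonSplit ℚ L₃ T5EisensteinSplitPlace.v₇ := by
  rintro ⟨w, hw, huniq⟩
  haveI := hw
  obtain ⟨w', hw', hne, -⟩ := T5CompletionDegreeSum.exists_ne_of_finrank_eq_one T5EisensteinSplitPlace.v₇
    T5EisensteinField.finrank_eq_two w (T5EisensteinSplitPlace.finrank_eq_one w)
  exact hne (huniq w' hw')

/-- `7` has kind `sp`. -/
theorem kindOf_v₇ : kindOf ℚ L₃ (Sum.inl T5EisensteinSplitPlace.v₇) = PlaceKind.sp := by
  rw [kindOf_inl, if_neg not_isNonSplit_v₇]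

/-- `2` has kind `ns` (inert). -/
theorem kindOf_v₂_L₃ : kindOf ℚ L₃ (Sum.inl T5GaussianField.v₂) = PlaceKind.ns :=
  kindOf_eq_ns isNonSplit_v₂_L₃

/-- `3` has kind `ns` (ramified). -/
theorem kindOf_v₃ : kindOf ℚ L₃ (Sum.inl v₃) = PlaceKind.ns :=
  kindOf_eq_ns isNonSplit_v₃

/-- EVERY KIND OCCURS among the places of `ℚ` relative to `ℚ(ζ₃)`: `ns` at `2` (and `3`), `sp` at `7`, `re` at
the real place — none of the three clauses of a sign model on `GlobalIndex ℚ` is vacuous there. -/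
theorem kindOf_surjective_L₃ : Function.Surjective (kindOf ℚ L₃) := by
  intro k
  cases k with
  | ns => exact ⟨Sum.inl T5GaussianField.v₂, kindOf_v₂_L₃⟩
  | sp => exact ⟨Sum.inl T5EisensteinSplitPlace.v₇, kindOf_v₇⟩
  | re =>
    obtain ⟨τ, hτ⟩ := exists_real_place_rat
    exact ⟨Sum.inr ⟨τ, hτ⟩, rfl⟩

end Eisenstein

end

end Summit.Ventures.HodgeRepro2.T6.N5LocalSignModelDichotomy
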